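import Summits.QuantumFields.BalabanUV.Beta.FP.CompositeAveragingTablesInf
import Literature.MathematicalPhysics.QuantumFieldTheory.Balaban1983to89.Beta.KKTFluctuationEnergy

/-!
# `BalabanUV.Beta.FP.CompositeAveragingTablesTranslate` — road «FP» for binder row D1, RULING R-FP-45 (B)∕(E) + OWNER WORD l.33765 (c): THE COARSE-TRANSLATION
# COVARIANCE OF THE COMPOSITE AVERAGING TABLES of FILE D1 (`aComp`, `HComp`, `M2Comp`) — the (T)-rows the END's `W2SymOfK_translate` asks of the m-fold carrier's
# multiplier ∕ mixed slots — by induction over the BOTTOM recursion from the ONE-step translation laws of `(q, H, M₂)`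

HONEST DEPENDENCY (page 1, mandatory): continuum YM on T⁴ ⇐ BetaPertH ∧ nine spine estimates (0/9 proved); BetaPertH ⇐ (D1) ∧ (D4) ∧ CAP+tail;
G-an2-4 gates asym, D1 and NE2/3/4.  HONEST FRAMING (cell contract, verbatim): «discharging `BetaPertH` makes Bałaban's UV stability UNCONDITIONAL —
a real constructive-QFT result; it is NOT the continuum limit and NOT the Clay problem.»  THIS MODULE DISCHARGES NOTHING of the wall: [folklore] index
bookkeeping over OUR typed composite tables (FILE D1 `CompositeAveragingTablesInf`): shifting the level-`m` coarse index by `t` shifts every fine leg by `Lc^m • t`.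
No `def`, no `def … : Prop`, nothing cited, 0 sorry; 0 estimates; 0∕4 row-D1 binders; NOT X1m, NOT (CONV-C), NOT SDF, NOT D1, NOT BetaPertH, NOT continuum, NOT Clay.

ABSOLUTE RULE (cell charter, verbatim): «No internally-minted statement may enter as a cited fact. Every hypothesis is either kernel-proved in this package or a
verbatim quotation of a PUBLISHED theorem with page reference. The manuscript(s) under audit are NOT citable for their own disputed steps — they are the thing
under adjudication; programme-internal (2001/route/tribunal) claims are never citable.»

WHY.  an2's `SecondOrderResponse.W2SymOfK_translate` (the (Wt) row of the carrier) asks of the multiplier slot `M ρ (w + t) = shiftK (−N•t) (M ρ w)` and of the mixed slot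
`M₂ κ (u + N•t) ρ (w + t) = shiftK (−N•t) (M₂ κ u ρ w)` at the carrier's blocking `N`.  For FILE D2's m-fold carrier `WtInf … m` (`N = Lc^m`) these slots are the
COMPOSITE tables `MCompInf m = cΛ • HComp … m`, `M2CompInf m = M2Comp … m`; this file proves their covariance from the one-step laws (T-q) `q ρ (w + t) κ (u + Lc•t) = q ρ w κ u`,
(T-H) `H σ (v + t) = shiftK (−Lc•t) (H σ v)` (= `SymTables.hHt`), (T-M₂) `M₂ κ (u + Lc•t) σ (v + t) = shiftK (−Lc•t) (M₂ κ u σ v)` (= `SymTables.hmixt`).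

CONTENTS (all [folklore]).
* §0 kernel plumbing: `cwsum_translate₂` (two families), `shiftK_wKer`∕`shiftK_wKerT`, `upK_shiftK`, `hRow_translate`∕`hRowT_translate`, **`liftF_shiftK`**, **`liftFH_translate`**.
* §1 **`aComp_translate`** (`aComp m ρ (w + t) κ (u + Lc^m•t) = aComp m ρ w κ u`), **`HComp_translate`** (`HComp m ρ (w + t) = shiftK (−Lc^m•t) (HComp m ρ w)`),
  **`M2Comp_translate`** (`M2Comp m κ (u + Lc^m•t) ρ (w + t) = shiftK (−Lc^m•t) (M2Comp m κ u ρ w)`) — induction over the bottom recursion.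
Provenance: D1 formalisation swarm LEAF PROVER 02, unit b2b-balaban-beta-d1-formalise-leaf-02 gen 14, 2026-08-21; OWNER GO l.33765 (c) («NOT IN v1» item of INTENT 2 l.33854).
-/

noncomputable section

namespace Summit.QuantumFields.BalabanUV.Beta.FP.CompositeAveragingTablesTranslate

open Finset
open scoped BigOperators
open Literature.MathematicalPhysics.QuantumFieldTheory
open Literature.MathematicalPhysics.QuantumFieldTheory.Balaban1983to89.Beta
open Literature.Probability.LatticeModels (Torus.proj)
open LatticeForm (quo proj_add_zsmul)
open BlochFibreUniqueness (quo_add_zsmul)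
open ExpKernelCalculus (Site MKer comp shiftK comp_shiftK)
open OneStepResolventKernel (Fib)
open InterLevelTransport (cwsum cwsum_apply)
open KKTFluctuationEnergy (tsum_shift)
open Summit.QuantumFields.BalabanUV.Beta.FP.CompositeAveragingTablesInf

variable {d : ℕ}

/-! ## §0 Kernel plumbing: how the lifts and superpositions of FILE D1 move under coarse shifts -/

section Plumbing

variable {N : ℕ} [NeZero N] (q : Fin (d + 1) → Site (d + 1) → Fin (d + 1) → Site (d + 1) → ℝ)

/-- [folklore] **TWO-FAMILY COARSE TRANSLATION OF A SUPERPOSITION**: if the family `Q′` is the family `Q` shifted by `T` (`Q′ (y + T) = shiftK (−N•T) (Q y)`), then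
superposing `Q′` with weights shifted by `T` is the shift of the superposition of `Q` (cf. `InterLevelTransport.cwsum_translate`, the case `Q′ = Q`). -/
theorem cwsum_translate₂ (w : Site (d + 1) → ℝ) {Q Q' : Site (d + 1) → MKer (d + 1) (Fib d)} (T : Site (d + 1))
    (hQ : ∀ y, Q' (y + T) = shiftK (-((N : ℤ) • T)) (Q y)) :
    cwsum N (fun y => w (y - T)) Q' = shiftK (-((N : ℤ) • T)) (cwsum N w Q) := by
  funext x z a b
  rw [cwsum_apply]
  simp only [ExpKernelCalculus.shiftK]
  rw [cwsum_apply, ← tsum_shift (fun y => w (y - T) * Q' y x z a b) T]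
  refine tsum_congr (fun y => ?_)
  rw [add_sub_cancel_right, hQ y]
  rfl

/-- [folklore] The one-step weight kernel is invariant under coarse shifts when the weight is (T-q)-covariant. -/
theorem shiftK_wKer (hq : ∀ (ρ : Fin (d + 1)) (w : Site (d + 1)) (κ : Fin (d + 1)) (u t : Site (d + 1)),
      q ρ (w + t) κ (u + (N : ℤ) • t) = q ρ w κ u) (T : Site (d + 1)) :
    shiftK (-((N : ℤ) • T)) (wKer N q) = wKer N q := by
  funext y x e a
  simp only [ExpKernelCalculus.shiftK]
  rcases e with σ | m
  · rcases a with κ | m'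
    · rw [wKer_inl_inl, wKer_inl_inl, show -((N : ℤ) • T) = (N : ℤ) • (-T) from (smul_neg _ _).symm, proj_add_zsmul, quo_add_zsmul]
      split_ifs with hy
      · have h := hq σ (quo N y + -T) κ (x + (N : ℤ) • -T) T
        rw [neg_add_cancel_right, smul_neg, neg_add_cancel_right] at h
        rw [smul_neg]
        exact h.symm
      · rfl
    · rfl
  · rw [wKer_inr, wKer_inr]

/-- [folklore] … and so is its transpose. -/
theorem shiftK_wKerT (hq : ∀ (ρ : Fin (d + 1)) (w : Site (d + 1)) (κ : Fin (d + 1)) (u t : Site (d + 1)),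
      q ρ (w + t) κ (u + (N : ℤ) • t) = q ρ w κ u) (T : Site (d + 1)) :
    shiftK (-((N : ℤ) • T)) (wKerT N q) = wKerT N q := by
  funext x y a e
  show wKer N q (y + -((N : ℤ) • T)) (x + -((N : ℤ) • T)) e a = wKer N q y x e a
  exact congrFun (congrFun (congrFun (congrFun (shiftK_wKer q hq T) y) x) e) a

/-- [folklore] Extension by zero commutes with shifts: `upK N (shiftK (−T) X) = shiftK (−N•T) (upK N X)`. -/
theorem upK_shiftK (X : MKer (d + 1) (Fib d)) (T : Site (d + 1)) :
    upK N (shiftK (-T) X) = shiftK (-((N : ℤ) • T)) (upK N X) := by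
  funext y y' e f
  simp only [ExpKernelCalculus.shiftK, upK]
  rw [show -((N : ℤ) • T) = (N : ℤ) • (-T) from (smul_neg _ _).symm, proj_add_zsmul, proj_add_zsmul, quo_add_zsmul, quo_add_zsmul]

/-- [folklore] The Hessian-row kernel of a (T-H)-covariant table translates: `hRow N H κ (u + N•T) = shiftK (−N•T) (hRow N H κ u)`. -/
theorem hRow_translate {H : Fin (d + 1) → Site (d + 1) → MKer (d + 1) (Fib d)}
    (hH : ∀ (σ : Fin (d + 1)) (v t : Site (d + 1)), H σ (v + t) = shiftK (-((N : ℤ) • t)) (H σ v))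
    (κ : Fin (d + 1)) (u T : Site (d + 1)) :
    hRow N H κ (u + (N : ℤ) • T) = shiftK (-((N : ℤ) • T)) (hRow N H κ u) := by
  funext x y a e
  simp only [ExpKernelCalculus.shiftK]
  rcases a with α | m
  · rcases e with σ | m'
    · rw [hRow_inl_inl, hRow_inl_inl, show -((N : ℤ) • T) = (N : ℤ) • (-T) from (smul_neg _ _).symm, proj_add_zsmul, quo_add_zsmul]
      split_ifs with hy
      · have h := hH σ (quo N y + -T) T
        rw [neg_add_cancel_right] at h
        rw [h]
        simp only [ExpKernelCalculus.shiftK, smul_neg]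
        congr 1
        abel
      · rfl
    · rfl
  · rw [hRow_inr, hRow_inr]

/-- [folklore] … and so does its transpose. -/
theorem hRowT_translate {H : Fin (d + 1) → Site (d + 1) → MKer (d + 1) (Fib d)}
    (hH : ∀ (σ : Fin (d + 1)) (v t : Site (d + 1)), H σ (v + t) = shiftK (-((N : ℤ) • t)) (H σ v))
    (κ : Fin (d + 1)) (u T : Site (d + 1)) :
    hRowT N H κ (u + (N : ℤ) • T) = shiftK (-((N : ℤ) • T)) (hRowT N H κ u) := by
  funext y x e a
  show hRow N H κ (u + (N : ℤ) • T) x y a e = hRow N H κ u (x + -((N : ℤ) • T)) (y + -((N : ℤ) • T)) a e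
  exact congrFun (congrFun (congrFun (congrFun (hRow_translate hH κ u T) x) y) a) e

/-- [folklore] **THE FIELD-LEG LIFT COMMUTES WITH COARSE SHIFTS**: `liftF N q (shiftK (−T) X) = shiftK (−N•T) (liftF N q X)` for a (T-q)-covariant weight. -/
theorem liftF_shiftK (hq : ∀ (ρ : Fin (d + 1)) (w : Site (d + 1)) (κ : Fin (d + 1)) (u t : Site (d + 1)),
      q ρ (w + t) κ (u + (N : ℤ) • t) = q ρ w κ u) (X : MKer (d + 1) (Fib d)) (T : Site (d + 1)) :
    liftF N q (shiftK (-T) X) = shiftK (-((N : ℤ) • T)) (liftF N q X) := by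
  unfold liftF
  rw [upK_shiftK, ← comp_shiftK, ← comp_shiftK, shiftK_wKer q hq, shiftK_wKerT q hq]

/-- [folklore] **THE DERIVED LIFT TRANSLATES**: `liftFH N q H κ (u + N•T) (shiftK (−T) X) = shiftK (−N•T) (liftFH N q H κ u X)`. -/
theorem liftFH_translate (hq : ∀ (ρ : Fin (d + 1)) (w : Site (d + 1)) (κ : Fin (d + 1)) (u t : Site (d + 1)),
      q ρ (w + t) κ (u + (N : ℤ) • t) = q ρ w κ u)
    {H : Fin (d + 1) → Site (d + 1) → MKer (d + 1) (Fib d)}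
    (hH : ∀ (σ : Fin (d + 1)) (v t : Site (d + 1)), H σ (v + t) = shiftK (-((N : ℤ) • t)) (H σ v))
    (κ : Fin (d + 1)) (u : Site (d + 1)) (X : MKer (d + 1) (Fib d)) (T : Site (d + 1)) :
    liftFH N q H κ (u + (N : ℤ) • T) (shiftK (-T) X) = shiftK (-((N : ℤ) • T)) (liftFH N q H κ u X) := by
  unfold liftFH
  rw [upK_shiftK, hRow_translate hH, hRowT_translate hH]
  conv_rhs => rw [show shiftK (-((N : ℤ) • T)) (comp (comp (hRow N H κ u) (upK N X)) (wKer N q) + comp (comp (wKerT N q) (upK N X)) (hRowT N H κ u))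
      = shiftK (-((N : ℤ) • T)) (comp (comp (hRow N H κ u) (upK N X)) (wKer N q))
        + shiftK (-((N : ℤ) • T)) (comp (comp (wKerT N q) (upK N X)) (hRowT N H κ u)) from rfl]
  rw [← comp_shiftK, ← comp_shiftK, ← comp_shiftK, ← comp_shiftK, shiftK_wKer q hq, shiftK_wKerT q hq]

end Plumbing

/-! ## §1 The composite tables translate -/

section Composite

variable (Lc : ℕ) [NeZero Lc] (q : Fin (d + 1) → Site (d + 1) → Fin (d + 1) → Site (d + 1) → ℝ) (lam : ℝ)
  (H : Fin (d + 1) → Site (d + 1) → MKer (d + 1) (Fib d))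
  (M₂ : Fin (d + 1) → Site (d + 1) → Fin (d + 1) → Site (d + 1) → MKer (d + 1) (Fib d)) (cΛ : ℝ)

omit [NeZero Lc] in
/-- [folklore] cast bookkeeping: `Lc^(m+2) • t = Lc • (Lc^(m+1) • t)` for the integer casts of the natural powers. -/
theorem zsmul_pow_succ_succ (m : ℕ) (t : Site (d + 1)) :
    (((Lc ^ (m + 2) : ℕ) : ℤ)) • t = (Lc : ℤ) • ((((Lc ^ (m + 1) : ℕ) : ℤ)) • t) := by
  rw [smul_smul]
  congr 1
  push_cast
  ring

/-- [folklore] `shiftK` is additive in the kernel. -/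
theorem shiftK_add (v : Site (d + 1)) (A B : MKer (d + 1) (Fib d)) : shiftK v (A + B) = shiftK v A + shiftK v B := rfl

/-- [folklore] `shiftK` commutes with scalars. -/
theorem shiftK_smul (v : Site (d + 1)) (c : ℝ) (A : MKer (d + 1) (Fib d)) : shiftK v (c • A) = c • shiftK v A := rfl

/-- [folklore] `shiftK` commutes with finite sums of kernels. -/
theorem shiftK_finset_sum {ι : Type*} (v : Site (d + 1)) (s : Finset ι) (A : ι → MKer (d + 1) (Fib d)) :
    shiftK v (∑ i ∈ s, A i) = ∑ i ∈ s, shiftK v (A i) := by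
  funext x y a b
  simp only [ExpKernelCalculus.shiftK, Finset.sum_apply]

omit [NeZero Lc] in
/-- [folklore] **THE COMPOSITE WEIGHTS TRANSLATE**: shifting the level-`m` coarse bond by `t` and the fine bond by `Lc^m • t` leaves `aComp m` unchanged, from the
one-step law (T-q) by induction over the bottom recursion (re-indexing the level-1 sum by `Lc^(m+1) • t`). -/
theorem aComp_translate
    (hq : ∀ (ρ : Fin (d + 1)) (w : Site (d + 1)) (κ : Fin (d + 1)) (u t : Site (d + 1)), q ρ (w + t) κ (u + (Lc : ℤ) • t) = q ρ w κ u) :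
    ∀ (m : ℕ) (ρ : Fin (d + 1)) (w : Site (d + 1)) (κ : Fin (d + 1)) (u t : Site (d + 1)),
      aComp q lam m ρ (w + t) κ (u + (((Lc ^ m : ℕ) : ℤ)) • t) = aComp q lam m ρ w κ u
  | 0 => fun ρ w κ u t => by
      simp only [aComp_zero, pow_zero, Nat.cast_one, one_smul, add_left_inj]
  | 1 => fun ρ w κ u t => by
      rw [aComp_one, pow_one]
      exact hq ρ w κ u t
  | m + 2 => fun ρ w κ u t => by
      rw [aComp_succ_succ, aComp_succ_succ, zsmul_pow_succ_succ,
        ← tsum_shift (fun v => ∑ σ : Fin (d + 1), aComp q lam (m + 1) ρ (w + t) σ v * q σ v κ (u + (Lc : ℤ) • ((((Lc ^ (m + 1) : ℕ) : ℤ)) • t)))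
          ((((Lc ^ (m + 1) : ℕ) : ℤ)) • t)]
      refine congrArg (lam * ·) (tsum_congr fun v => Finset.sum_congr rfl fun σ _ => ?_)
      rw [aComp_translate hq (m + 1) ρ w σ v t, hq]

/-- [folklore] **THE COMPOSITE CONSTRAINT HESSIANS TRANSLATE**: `HComp m ρ (w + t) = shiftK (−Lc^m • t) (HComp m ρ w)` from (T-q), (T-H). -/
theorem HComp_translate
    (hq : ∀ (ρ : Fin (d + 1)) (w : Site (d + 1)) (κ : Fin (d + 1)) (u t : Site (d + 1)), q ρ (w + t) κ (u + (Lc : ℤ) • t) = q ρ w κ u)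
    (hH : ∀ (σ : Fin (d + 1)) (v t : Site (d + 1)), H σ (v + t) = shiftK (-((Lc : ℤ) • t)) (H σ v)) :
    ∀ (m : ℕ) (ρ : Fin (d + 1)) (w t : Site (d + 1)),
      HComp Lc q lam H m ρ (w + t) = shiftK (-((((Lc ^ m : ℕ) : ℤ)) • t)) (HComp Lc q lam H m ρ w)
  | 0 => fun _ _ _ => rfl
  | 1 => fun ρ w t => by
      rw [HComp_one, pow_one]
      exact hH ρ w t
  | m + 2 => fun ρ w t => by
      set T₁ : Site (d + 1) := (((Lc ^ (m + 1) : ℕ) : ℤ)) • t with hT₁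
      -- the composite weights above, shifted
      have ha : ∀ σ : Fin (d + 1), aComp q lam (m + 1) ρ (w + t) σ = fun v => aComp q lam (m + 1) ρ w σ (v - T₁) := by
        intro σ; funext v
        have h := aComp_translate Lc q lam hq (m + 1) ρ w σ (v - T₁) t
        rwa [hT₁, sub_add_cancel] at h
      -- first family: superposition of the one-step Hessians
      have h1 : ∀ σ : Fin (d + 1), cwsum Lc (aComp q lam (m + 1) ρ (w + t) σ) (H σ)
          = shiftK (-((Lc : ℤ) • T₁)) (cwsum Lc (aComp q lam (m + 1) ρ w σ) (H σ)) := by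
        intro σ
        rw [ha σ]
        exact cwsum_translate₂ _ T₁ (fun y => hH σ y T₁)
      -- second family: the lift of the upper Hessian
      have h2 : liftF Lc q (HComp Lc q lam H (m + 1) ρ (w + t)) = shiftK (-((Lc : ℤ) • T₁)) (liftF Lc q (HComp Lc q lam H (m + 1) ρ w)) := by
        rw [HComp_translate hq hH (m + 1) ρ w t, ← hT₁, liftF_shiftK q hq]
      rw [HComp_succ_succ, HComp_succ_succ, zsmul_pow_succ_succ, ← hT₁, shiftK_add, shiftK_smul, shiftK_smul, shiftK_finset_sum, h2,
        Finset.sum_congr rfl fun σ _ => h1 σ]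

/-- [folklore] **THE COMPOSITE MIXED TABLES TRANSLATE**: `M2Comp m κ (u + Lc^m • t) ρ (w + t) = shiftK (−Lc^m • t) (M2Comp m κ u ρ w)` from (T-q), (T-H), (T-M₂)
— the four families of the third-order chain rule each translate (weights re-indexed by `Lc^(m+1) • t`, kernel families shifted). -/
theorem M2Comp_translate
    (hq : ∀ (ρ : Fin (d + 1)) (w : Site (d + 1)) (κ : Fin (d + 1)) (u t : Site (d + 1)), q ρ (w + t) κ (u + (Lc : ℤ) • t) = q ρ w κ u)
    (hH : ∀ (σ : Fin (d + 1)) (v t : Site (d + 1)), H σ (v + t) = shiftK (-((Lc : ℤ) • t)) (H σ v))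
    (hM₂ : ∀ (κ : Fin (d + 1)) (u : Site (d + 1)) (σ : Fin (d + 1)) (v t : Site (d + 1)),
      M₂ κ (u + (Lc : ℤ) • t) σ (v + t) = shiftK (-((Lc : ℤ) • t)) (M₂ κ u σ v)) :
    ∀ (m : ℕ) (κ : Fin (d + 1)) (u : Site (d + 1)) (ρ : Fin (d + 1)) (w t : Site (d + 1)),
      M2Comp Lc q lam H M₂ cΛ m κ (u + (((Lc ^ m : ℕ) : ℤ)) • t) ρ (w + t) = shiftK (-((((Lc ^ m : ℕ) : ℤ)) • t)) (M2Comp Lc q lam H M₂ cΛ m κ u ρ w)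
  | 0 => fun _ _ _ _ _ => rfl
  | 1 => fun κ u ρ w t => by
      rw [M2Comp_one, pow_one]
      exact hM₂ κ u ρ w t
  | m + 2 => fun κ u ρ w t => by
      set T₁ : Site (d + 1) := (((Lc ^ (m + 1) : ℕ) : ℤ)) • t with hT₁
      have ha : ∀ σ : Fin (d + 1), aComp q lam (m + 1) ρ (w + t) σ = fun v => aComp q lam (m + 1) ρ w σ (v - T₁) := by
        intro σ; funext v
        have h := aComp_translate Lc q lam hq (m + 1) ρ w σ (v - T₁) t
        rwa [hT₁, sub_add_cancel] at h
      have hHC : HComp Lc q lam H (m + 1) ρ (w + t) = shiftK (-T₁) (HComp Lc q lam H (m + 1) ρ w) := by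
        rw [HComp_translate Lc q lam H hq hH (m + 1) ρ w t, ← hT₁]
      -- (iii): the composite weights against the shifted one-step mixed family
      have h3 : ∀ σ : Fin (d + 1), cwsum Lc (aComp q lam (m + 1) ρ (w + t) σ) (M₂ κ (u + (Lc : ℤ) • T₁) σ)
          = shiftK (-((Lc : ℤ) • T₁)) (cwsum Lc (aComp q lam (m + 1) ρ w σ) (M₂ κ u σ)) := by
        intro σ
        rw [ha σ]
        exact cwsum_translate₂ _ T₁ (fun y => hM₂ κ u σ y T₁)
      -- (ii): the upper Hessian contracted with the one-step weight — the weight function is the unshifted one re-indexed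
      have hw2 : ∀ σ : Fin (d + 1),
          (fun v => ∑ σ' : Fin (d + 1), ∑' v' : Site (d + 1),
              HComp Lc q lam H (m + 1) ρ (w + t) v v' (Sum.inl σ) (Sum.inl σ') * q σ' v' κ (u + (Lc : ℤ) • T₁))
          = fun v => (fun v₀ => ∑ σ' : Fin (d + 1), ∑' v' : Site (d + 1),
              HComp Lc q lam H (m + 1) ρ w v₀ v' (Sum.inl σ) (Sum.inl σ') * q σ' v' κ u) (v - T₁) := by
        intro σ; funext v
        rw [hHC]
        refine Finset.sum_congr rfl fun σ' _ => ?_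
        rw [← tsum_shift (fun v' => HComp Lc q lam H (m + 1) ρ w (v - T₁) v' (Sum.inl σ) (Sum.inl σ') * q σ' v' κ u) (-T₁)]
        refine tsum_congr fun v' => ?_
        simp only [ExpKernelCalculus.shiftK]
        have hq' := hq σ' (v' + -T₁) κ u T₁
        rw [neg_add_cancel_right] at hq'
        rw [hq', ← sub_eq_add_neg]
      have h2 : ∀ σ : Fin (d + 1),
          cwsum Lc (fun v => ∑ σ' : Fin (d + 1), ∑' v' : Site (d + 1),
              HComp Lc q lam H (m + 1) ρ (w + t) v v' (Sum.inl σ) (Sum.inl σ') * q σ' v' κ (u + (Lc : ℤ) • T₁)) (H σ)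
          = shiftK (-((Lc : ℤ) • T₁)) (cwsum Lc (fun v => ∑ σ' : Fin (d + 1), ∑' v' : Site (d + 1),
              HComp Lc q lam H (m + 1) ρ w v v' (Sum.inl σ) (Sum.inl σ') * q σ' v' κ u) (H σ)) := by
        intro σ
        rw [hw2 σ]
        exact cwsum_translate₂ (fun v₀ => ∑ σ' : Fin (d + 1), ∑' v' : Site (d + 1),
          HComp Lc q lam H (m + 1) ρ w v₀ v' (Sum.inl σ) (Sum.inl σ') * q σ' v' κ u) T₁ (fun y => hH σ y T₁)
      -- (iv): the derived lift
      have h4 : liftFH Lc q H κ (u + (Lc : ℤ) • T₁) (HComp Lc q lam H (m + 1) ρ (w + t))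
          = shiftK (-((Lc : ℤ) • T₁)) (liftFH Lc q H κ u (HComp Lc q lam H (m + 1) ρ w)) := by
        rw [hHC]
        exact liftFH_translate q hq hH κ u _ T₁
      -- (i): the upper mixed table, its U-slot transported by the one-step weight, pulled back by the lift
      have hw1 : ∀ σ' : Fin (d + 1), (fun v' => q σ' v' κ (u + (Lc : ℤ) • T₁)) = fun v' => (fun v₀ => q σ' v₀ κ u) (v' - T₁) := by
        intro σ'; funext v'
        have h := hq σ' (v' - T₁) κ u T₁
        rwa [sub_add_cancel] at h
      have h1 : ∀ σ' : Fin (d + 1),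
          cwsum Lc (fun v' => q σ' v' κ (u + (Lc : ℤ) • T₁)) (fun v' => liftF Lc q (M2Comp Lc q lam H M₂ cΛ (m + 1) σ' v' ρ (w + t)))
          = shiftK (-((Lc : ℤ) • T₁)) (cwsum Lc (fun v' => q σ' v' κ u) (fun v' => liftF Lc q (M2Comp Lc q lam H M₂ cΛ (m + 1) σ' v' ρ w))) := by
        intro σ'
        rw [hw1 σ']
        refine cwsum_translate₂ (N := Lc) (fun v₀ => q σ' v₀ κ u)
          (Q := fun v' => liftF Lc q (M2Comp Lc q lam H M₂ cΛ (m + 1) σ' v' ρ w)) T₁ (fun v' => ?_)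
        show liftF Lc q (M2Comp Lc q lam H M₂ cΛ (m + 1) σ' (v' + T₁) ρ (w + t)) = _
        rw [hT₁, M2Comp_translate hq hH hM₂ (m + 1) σ' v' ρ w t, liftF_shiftK q hq]
      rw [M2Comp_succ_succ, M2Comp_succ_succ, zsmul_pow_succ_succ, ← hT₁, shiftK_add, shiftK_add, shiftK_smul, shiftK_smul, shiftK_smul,
        shiftK_add, shiftK_finset_sum, shiftK_finset_sum, shiftK_finset_sum, h4,
        Finset.sum_congr rfl fun σ _ => h3 σ, Finset.sum_congr rfl fun σ _ => h2 σ, Finset.sum_congr rfl fun σ' _ => h1 σ']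

end Composite

end Summit.QuantumFields.BalabanUV.Beta.FP.CompositeAveragingTablesTranslate

end
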